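import Literature.AlgebraicGeometry.HodgeTheory.ComplexConjugation
import Literature.AlgebraicGeometry.HodgeTheory.HodgeFiltrationModelsReduction
import HarnessLib

/-!
# Hodge symmetry of every Hodge model: reduction to the rigidity of natural de Rham comparisons

Family `hodge`, layer `Literature/AlgebraicGeometry/HodgeTheory`. Companion to `ComplexConjugation`
(`HodgeModel.IsHodgeSymmetric A`: `conj H^{p,q} ⊆ H^{q,p}` for the pieces of the Hodge model `A`,
Voisin I Cor. 6.12; PROVED there for REAL models, `HodgeModel.IsReal.isHodgeSymmetric`, and vendored
as the existential named fact `exists_isReal_hodgeModel`) and to `HodgeFiltrationModelsReduction`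
(the proposition `NaturalDeRhamComparisonRigidity`: two natural complex de Rham comparison
families, read on a compact complex manifold through a diffeomorphism, differ by a scalar — the
unprinted differential-topology ingredient of `hodgePQ_independent_of_hodgeModel`, folklore from
Thom 1954).

PROVED here: **rigidity alone makes EVERY Hodge model of a smooth projective `X/ℂ` Hodge
symmetric** (`HodgeModel.isHodgeSymmetric_of_rigidity`), with no existence statement (no GAGA, no
de Rham theorem, no Hodge decomposition beyond the one the model carries) in the hypotheses. The
argument: let `A` be a Hodge model with natural comparison family `e = A.deRham` over the manifolds
charted on `A.model`. Complex conjugation of forms commutes with pull-back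
(`MForm.pullback_conj`, definitional), hence conjugation `c ↦ c̄` of complex de Rham classes
commutes with `f^*` (`complexDeRhamCohomology.conj_map`); conjugation of the values of singular
cochains commutes with `f^*` as well (`conjClass_map`, file `ComplexConjugation`). Therefore the
CONJUGATE family `ē_M := conj ∘ e_M ∘ conj` (`ℂ`-linear again) is a second natural complex de Rham
comparison family on the same model space, and `NaturalDeRhamComparisonRigidity` applied to
`e`, `ē` and the identity diffeomorphism of the compact carrier `X^an` gives a scalar `r` with
`ē = r • e` on `Hᵏ_dR(X^an; ℂ)`, i.e. `conj (e ω) = r • e (ω̄)`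
(`HodgeModel.exists_conjClass_deRham_eq_smul_of_rigidity`: every model is real UP TO A SCALAR).
Since `conj K^{p,q} = K^{q,p}` on de Rham classes is a theorem of the tree
(`Motives.conj_hodgePQ_eq`, Voisin I Cor. 6.12 "it is obvious that `conj K^{p,q} = K^{q,p}`"),
`conj (e K^{p,q}) = r • e (K^{q,p}) ⊆ H^{q,p}`.

Consequence for Grothendieck's parity argument (Topology 8 (1969), p. 300; barrier catalogue,
`Literature/Barriers/HodgeConjecture/GeneralizedHodgeTrivialReasons{SubHodge,Parity,Rigidity}`):
the parity step — a `ℚ`-independent family of rational classes of odd degree whose complex span is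
a sub-Hodge structure has even cardinality —, proved there in any ONE Hodge symmetric model
(`even_of_isSubHodge_of_isHodgeSymmetric`; Hodge symmetry is part of the definition of a Hodge
structure, Voisin I Def. 7.4), holds in EVERY Hodge model given `NaturalDeRhamComparisonRigidity`
and the pull-back calculus `PullbackFacts` alone (`even_of_isSubHodge_of_rigidity`, filed
downstream in the barrier catalogue), with no existence statement (`exists_isReal_hodgeModel`) and
without `hodgePQ_independent_of_hodgeModel` (itself reduced to rigidity + `PullbackFacts` in
`HodgeFiltrationModelsReduction`).

Hypotheses kept explicit: `NaturalDeRhamComparisonRigidity` (a `Prop` of the tree, NOT a named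
fact asserted here) and the pull-back calculus `[PullbackFacts 𝓘(ℝ, E) M 𝓘(ℝ, E) M ℂ]` on the
carrier (named facts `IsSmoothFormPullback`, `MextDerivPullback`, Warner 2.22–2.23, needed to read
the identity as a `C^∞` map on de Rham classes, `complexDeRhamCohomology.map_id`). Compactness of
the carrier comes from `IsSmoothProjective` (`X → Spec ℂ` proper, Hartshorne II.4.9; `X(ℂ)` compact,
Serre GAGA §2 n°7 Prop. 6), as in `hodgePQ_independent_of_hodgeModel_of_rigidity`.

Not here: any attempt at rigidity itself or at `PullbackFacts` (separate programmes), and the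
barrier-side corollaries (kept downstream of `HodgeTheory`).

## References

* C. Voisin, *Hodge Theory and Complex Algebraic Geometry I* (2002), §6.1.3, Prop. 6.11, Cor. 6.12.
* R. Thom, *Quelques propriétés globales des variétés différentiables*, Comment. Math. Helv. 28
  (1954), Thm. II.29, Cor. II.30 (source of the rigidity folklore, see `HodgeFiltrationModelsReduction`).
* R. O. Wells, *Differential Analysis on Complex Manifolds* (1980), Ch. II §1, Thm. III.4.13.
* A. Hatcher, *Algebraic Topology* (2002), §3.1 (naturality of induced maps on cochains).
-/

noncomputable section

open scoped Manifold ContDiff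
open CategoryTheory
open Literature.NumberTheory.Transcendental (ComplexDeRhamIsoFamily complexDeRhamCohomology
  PullbackFacts conj_mem_cclosedSmoothForms conj_mem_cexactSmoothForms
  conj_mem_cclosedSmoothForms_holds conj_mem_cexactSmoothForms_holds)

namespace Literature.AlgebraicGeometry.HodgeTheory

section HodgeTheory

/-! ### Conjugation commutes with pull-back: forms and de Rham classes -/

section Forms

variable {E : Type*} [NormedAddCommGroup E] [NormedSpace ℂ E]
  {M : Type*} [TopologicalSpace M] [ChartedSpace E M]
  {E' : Type*} [NormedAddCommGroup E'] [NormedSpace ℂ E']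
  {N : Type*} [TopologicalSpace N] [ChartedSpace E' N] {k : ℕ}

/-- **Conjugation of complex forms commutes with pull-back**: `conj (f^* β) = f^* (conj β)` for any map
`f : M → N` of manifolds modelled on complex normed spaces and any complex `k`-form `β` on `N`
(both sides evaluate to `conj (β (f x) (df_x v₁, …, df_x v_k))`; definitional). Dot-notation
extension of `Literature.Geometry.Kaehler.MForm` (defined in `Geometry/Kaehler/ManifoldForms`,
`MForm.conj` in `NumberTheory/Transcendental/ComplexForms`) declared from its first consumer.
[folklore] -/
theorem _root_.Literature.Geometry.Kaehler.MForm.pullback_conj (f : M → N)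
    (β : Literature.Geometry.Kaehler.MForm 𝓘(ℝ, E') N ℂ k) :
    (β.pullback 𝓘(ℝ, E) f).conj = β.conj.pullback 𝓘(ℝ, E) f := by
  funext x
  ext v
  rfl

variable [IsManifold 𝓘(ℝ, E) ∞ M] [IsManifold 𝓘(ℝ, E') ∞ N] [PullbackFacts 𝓘(ℝ, E) M 𝓘(ℝ, E') N ℂ]

/-- **Conjugation of complex de Rham classes commutes with pull-back**: for a `C^∞` map
`f : M → N`, `conj (f^* c) = f^* (conj c)` on `Hᵏ_dR(–; ℂ)`, where `conj` is
`complexDeRhamCohomology.conj` (`Motives/HodgeDecomposition`, under its conjugation hypotheses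
`hc, he`, resp. `hc', he'`, on `M` and on `N`) and `f^*` is `complexDeRhamCohomology.map` (under the
pull-back calculus `[PullbackFacts 𝓘(ℝ, E) M 𝓘(ℝ, E') N ℂ]`). On representatives this is
`MForm.pullback_conj`. Voisin I, Cor. 6.12: "complex conjugation acts naturally". Deliberate
extension of the namespace `Literature.NumberTheory.Transcendental.complexDeRhamCohomology`
(as `complexDeRhamCohomology.conj` itself). [cite: VoisinHodgeI2002, Cor. 6.12] -/
theorem _root_.Literature.NumberTheory.Transcendental.complexDeRhamCohomology.conj_map
    (hc : conj_mem_cclosedSmoothForms (E := E) (M := M) (k := k))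
    (he : conj_mem_cexactSmoothForms (E := E) (M := M) (k := k))
    (hc' : conj_mem_cclosedSmoothForms (E := E') (M := N) (k := k))
    (he' : conj_mem_cexactSmoothForms (E := E') (M := N) (k := k))
    {f : M → N} (hf : ContMDiff 𝓘(ℝ, E) 𝓘(ℝ, E') ∞ f) (c : complexDeRhamCohomology E' N k) :
    complexDeRhamCohomology.conj E M k hc he (complexDeRhamCohomology.map E hf k c) =
      complexDeRhamCohomology.map E hf k (complexDeRhamCohomology.conj E' N k hc' he' c) := by
  obtain ⟨β, rfl⟩ := complexDeRhamCohomology.mk_surjective c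
  rw [complexDeRhamCohomology.map_mk, complexDeRhamCohomology.conj_mk,
    complexDeRhamCohomology.conj_mk, complexDeRhamCohomology.map_mk]
  congr 1

end Forms

/-! ### Every Hodge model is real up to a scalar, hence Hodge symmetric, given rigidity -/

section Model

variable {n : ℕ} {X : Motives.SchemeOver ℂ}

/-- **Rigidity makes the comparison of every Hodge model real up to a scalar.** Let `X` be smooth
projective of dimension `n` over `ℂ`, `A` a Hodge model of `X` (analytification `X^an` + natural
complex de Rham comparison family `e = A.deRham` + Hodge decomposition), and assume
`NaturalDeRhamComparisonRigidity` and the pull-back calculus on `X^an`. Then in each degree `k`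
there is `r : ℂ` with `conj (e ω) = r • e (conj ω)` for all `ω ∈ Hᵏ_dR(X^an; ℂ)` — conjugation of
cochain values on the left (`conjClass`), of forms on the right (`complexDeRhamCohomology.conj`,
fed with the tree's theorems `conj_mem_cclosedSmoothForms_holds`, `conj_mem_cexactSmoothForms_holds`).
Proof: the conjugate family `ē_M = conj ∘ e_M ∘ conj` is a natural complex de Rham comparison
family on the manifolds charted on `A.model` (`complexDeRhamCohomology.conj_map`, `conjClass_map`,
naturality of `e`); rigidity for `e`, `ē` and the identity of the compact carrier (`X(ℂ)` is
compact, Serre GAGA §2 n°7 Prop. 6) gives `ē = r • e`. A REAL model (`HodgeModel.IsReal`) is the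
case `r = 1`; Voisin I §6.1.3: the comparison "`H^k(X, ℂ) = H^k(X, ℝ) ⊗ ℂ`" is real.
[cite: VoisinHodgeI2002, §6.1.3 Cor. 6.12] [cite: SerreGAGA1956, §2 n°7 Prop. 6] -/
theorem HodgeModel.exists_conjClass_deRham_eq_smul_of_rigidity
    (hR : NaturalDeRhamComparisonRigidity) (hX : Motives.IsSmoothProjective n X)
    (A : HodgeModel n X) [PullbackFacts 𝓘(ℝ, A.model) A.carrier 𝓘(ℝ, A.model) A.carrier ℂ]
    (k : ℕ) :
    ∃ r : ℂ, ∀ y : complexDeRhamCohomology A.model A.carrier k,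
      conjClass A.carrier k (A.deRham A.carrier k y) =
        r • A.deRham A.carrier k (complexDeRhamCohomology.conj A.model A.carrier k
          conj_mem_cclosedSmoothForms_holds conj_mem_cexactSmoothForms_holds y) := by
  haveI : CompleteSpace A.model := FiniteDimensional.complete ℂ A.model
  -- the carrier is compact: `X(ℂ)` is compact and the comparison map is a homeomorphism
  haveI : AlgebraicGeometry.IsProper X.hom := Motives.IsSmoothProjective.isProper_holds hX
  haveI : CompactSpace (Motives.ComplexPoints X) :=
    Motives.compactSpace_algPoints_of_isProper_holds X ℂ
  haveI : CompactSpace A.carrier := A.isAnalytification.homeomorph.symm.compactSpace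
  -- the conjugate family `ē_M = conj ∘ e_M ∘ conj`
  let ē : ComplexDeRhamIsoFamily A.model := fun M _ _ _ _ _ k ↦
    { toFun := fun c ↦ conjClass M k (A.deRham M k (complexDeRhamCohomology.conj A.model M k
        conj_mem_cclosedSmoothForms_holds conj_mem_cexactSmoothForms_holds c))
      invFun := fun x ↦ complexDeRhamCohomology.conj A.model M k
        conj_mem_cclosedSmoothForms_holds conj_mem_cexactSmoothForms_holds
          ((A.deRham M k).symm (conjClass M k x))
      map_add' := fun c c' ↦ by
        simp only [map_add, conjClass_add]
      map_smul' := fun a c ↦ by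
        simp only [LinearMap.map_smulₛₗ, map_smul, conjClass_smul, RingHom.id_apply,
          starRingEnd_self_apply]
      left_inv := fun c ↦ by
        simp only [conjClass_conjClass, LinearEquiv.symm_apply_apply,
          complexDeRhamCohomology.conj_conj]
      right_inv := fun x ↦ by
        simp only [complexDeRhamCohomology.conj_conj, LinearEquiv.apply_symm_apply,
          conjClass_conjClass] }
  have hē_apply : ∀ (M : Type) [TopologicalSpace M] [ChartedSpace A.model M]
      [IsManifold 𝓘(ℝ, A.model) ∞ M] [T2Space M] [SigmaCompactSpace M] (k : ℕ)
      (c : complexDeRhamCohomology A.model M k),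
      ē M k c = conjClass M k (A.deRham M k (complexDeRhamCohomology.conj A.model M k
        conj_mem_cclosedSmoothForms_holds conj_mem_cexactSmoothForms_holds c)) :=
    fun M _ _ _ _ _ k c ↦ rfl
  -- `ē` is natural: conjugation commutes with pull-back on both sides, `e` is natural
  have hē : ē.IsNatural := by
    intro M N _ _ _ _ _ _ _ _ _ _ _ f hf k c
    rw [hē_apply, hē_apply, complexDeRhamCohomology.conj_map conj_mem_cclosedSmoothForms_holds
      conj_mem_cexactSmoothForms_holds conj_mem_cclosedSmoothForms_holds
      conj_mem_cexactSmoothForms_holds hf c, A.deRham_isNatural M N f hf k, conjClass_map]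
  -- rigidity for `e`, `ē` and the identity of the carrier
  have hh : ContMDiff 𝓘(ℝ, A.model) 𝓘(ℝ, A.model) ∞ ⇑(Homeomorph.refl A.carrier) := contMDiff_id
  have hh' : ContMDiff 𝓘(ℝ, A.model) 𝓘(ℝ, A.model) ∞ ⇑(Homeomorph.refl A.carrier).symm :=
    contMDiff_id
  obtain ⟨r, hr⟩ := hR A.model A.model A.deRham A.deRham_isNatural ē hē A.carrier A.carrier
    (Homeomorph.refl A.carrier) hh hh' k
  have h1 : (⟨Homeomorph.refl A.carrier, (Homeomorph.refl A.carrier).continuous⟩ :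
      C(A.carrier, A.carrier)) = ContinuousMap.id A.carrier := rfl
  have h2 : complexDeRhamCohomology.map A.model hh k = LinearMap.id :=
    complexDeRhamCohomology.map_id (E := A.model) (M := A.carrier) k
  refine ⟨r, fun y ↦ ?_⟩
  have h := hr (complexDeRhamCohomology.conj A.model A.carrier k
    conj_mem_cclosedSmoothForms_holds conj_mem_cexactSmoothForms_holds y)
  rw [h1, h2, Literature.AlgebraicTopology.SingularHomology.singularCohomology.map_id, hē_apply,
    complexDeRhamCohomology.conj_conj, ModuleCat.id_apply, LinearMap.id_apply] at h
  exact h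

/-- **Rigidity makes every Hodge model Hodge symmetric** (`conj H^{p,q} ⊆ H^{q,p}`, Voisin I
Cor. 6.12, for an ARBITRARY Hodge model of a smooth projective `X/ℂ`, given
`NaturalDeRhamComparisonRigidity` and the pull-back calculus on `X^an`): with
`H^{p,q} = e(K^{p,q})`, `conj e(K^{p,q}) = r • e(conj K^{p,q})`
(`HodgeModel.exists_conjClass_deRham_eq_smul_of_rigidity`) `= r • e(K^{q,p}) ⊆ H^{q,p}`
(`Motives.conj_hodgePQ_eq`: "it is obvious that we have `conj K^{p,q} = K^{q,p}`"). Compare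
`HodgeModel.IsReal.isHodgeSymmetric` (real models, no rigidity) and
`exists_isReal_hodgeModel` (existence of one real model, a named fact): here no model is produced,
so nothing about the EXISTENCE of analytifications, de Rham comparisons or Hodge decompositions
enters. [cite: VoisinHodgeI2002, Cor. 6.12] -/
theorem HodgeModel.isHodgeSymmetric_of_rigidity (hR : NaturalDeRhamComparisonRigidity)
    (hX : Motives.IsSmoothProjective n X) (A : HodgeModel n X)
    [PullbackFacts 𝓘(ℝ, A.model) A.carrier 𝓘(ℝ, A.model) A.carrier ℂ] : A.IsHodgeSymmetric := by
  rintro k p q _ ⟨w, hw, rfl⟩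
  obtain ⟨r, hr⟩ := A.exists_conjClass_deRham_eq_smul_of_rigidity hR hX k
  change conjClass A.carrier k (A.deRham A.carrier k w) ∈ A.hodgePQ k q p
  rw [hr w]
  refine Submodule.smul_mem _ r
    (Submodule.mem_map_of_mem (f := (A.deRham A.carrier k).toLinearMap) ?_)
  rw [← Motives.conj_hodgePQ_eq conj_mem_cclosedSmoothForms_holds
    conj_mem_cexactSmoothForms_holds p q]
  exact Submodule.mem_map_of_mem hw

/-- **All Hodge models of all smooth projective complex varieties are Hodge symmetric, given
rigidity and the pull-back calculus** — the uniformly quantified form (pull-back calculus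
quantified as in `hodgePQ_independent_of_hodgeModel_of_rigidity`) consumed by the barrier catalogue
(`Grothendieck1969_rationalSupportedClasses_evenRank_of_rigidity`,
`Literature/Barriers/HodgeConjecture/GeneralizedHodgeTrivialReasonsRigidity`).
[cite: VoisinHodgeI2002, Cor. 6.12] -/
theorem forall_isHodgeSymmetric_of_rigidity (hR : NaturalDeRhamComparisonRigidity)
    (hPB : ∀ (E : Type) [NormedAddCommGroup E] [NormedSpace ℂ E] [FiniteDimensional ℂ E]
      (E' : Type) [NormedAddCommGroup E'] [NormedSpace ℂ E'] [FiniteDimensional ℂ E']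
      (M : Type) [TopologicalSpace M] [ChartedSpace E M] [IsManifold 𝓘(ℝ, E) ∞ M]
      (N : Type) [TopologicalSpace N] [ChartedSpace E' N] [IsManifold 𝓘(ℝ, E') ∞ N],
      PullbackFacts 𝓘(ℝ, E) M 𝓘(ℝ, E') N ℂ)
    (n : ℕ) (X : Motives.SchemeOver ℂ) (hX : Motives.IsSmoothProjective n X) (A : HodgeModel n X) :
    A.IsHodgeSymmetric :=
  haveI := hPB A.model A.model A.carrier A.carrier
  A.isHodgeSymmetric_of_rigidity hR hX

end Model

end HodgeTheory

end Literature.AlgebraicGeometry.HodgeTheory
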